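import Literature.AnabelianGeometry.SemiGraphs.CoveringGraphEstranged
import Literature.AnabelianGeometry.SemiGraphs.UniformSplittingStrictlyCoherentProofs
import Literature.AnabelianGeometry.SemiGraphs.TemperoidsGaloisObjectsProofs
import Literature.AnabelianGeometry.SemiGraphs.CharacteristicOpenCore
import Mathlib.Tactic.Group
import HarnessLib

/-!
# Approximators of covering semi-graphs of anabelioids: quasi-coherence and elevation are hereditary
# over a FINITE coherent base (route T, T7c)

Mochizuki, *Semi-graphs of anabelioids*, Publ. RIMS **42** (2006), §2, Def. 2.3 (approximators,
quasi-coherence), Def. 2.4 (i) (elevated vertices), Remark 2.4.1 (heredity along coverings), manuscript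
pp. 24–26 [cite: MochizukiSemiAnbd2006, Def 2.3 pp.24-25]; §3 Def. 3.5 (i) p. 37 (the covering
semi-graph of anabelioids `G_S → G` of an object `S` of `B^cov(G)`, tree: `CovObj.coveringGraph`).

PROOF-ONLY companion (abc-iut cell, L3 route T, brick T7c of abc-iut-L3-d6's plan
`SHAPES-T7-HereditaryHypotheses.md`, fields F6/F7; seat abc-iut-L3-t5).  CONTENT:
* `exists_approximator_coveringGraph` — every approximator `A` of `G` induces one of `G_S`: the vertex
  (edge) groups are the IMAGES `π_v(Stab_{Π_v}(s_ω))` inside `A`'s finite groups, the maps the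
  restrictions, the branch maps the `A`-branch maps conjugated by `π_v(g_{b'})·g_b⁻¹` (so that the
  compatibility 2-cell becomes trivial); it is always `π₁`-epimorphic, its kernels are the traces of
  `A`'s kernels, and its branch ranges lie in conjugates of `A`'s branch ranges — everything a
  consumer needs, in one existential (no definition is introduced);
* `isQuasiCoherent_coveringGraph_of_finite` — for `G` FINITE and COHERENT and `S` TEMPERED and
  CONNECTED, `G_S` is quasi-coherent;
* `isTotallyElevated_coveringGraph_of_finite` — for `G` FINITE, totally elevated, and `S` tempered
  connected, `G_S` is totally elevated.
SCOPE (honest): print's Rmk 2.4.1 asserts heredity of elevated / aloof / estranged along finite étale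
coverings; it does not assert heredity of quasi-coherence.  For an INFINITE base with vertex groups of
unbounded complexity and an infinite `S` the uniform bound needed by Def. 2.3 (iii) can fail, so the
statements here carry `[Finite 𝒢.graph.Vertex] [Finite 𝒢.graph.Edge]` — the case of [IUTchI]/[EtTh]
(finite dual graphs, infinite tempered coverings).  Nothing here bears on [IUTchIII] Cor. 3.12.
-/

namespace Literature.AnabelianGeometry.SemiGraphs

namespace ProfiniteSemiGraph

namespace CovObj

open Literature.AlgebraicGeometry.Frobenioids (IsConnectedObj)
open Literature.AlgebraicGeometry.Frobenioids.QuasiTemperoid.BTempConnected (ρ_mul_apply ρ_inv_apply ρ_one_apply)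
open Literature.AnabelianGeometry.AbsoluteAnabelian (IsTopologicallyFinitelyGenerated)

universe u

variable {𝒢 : ProfiniteSemiGraph.{u}} (S : CovObj 𝒢)

/-! ### The induced approximator of `G_S` -/

/-- **Every approximator of `G` induces an approximator of the covering semi-graph `G_S`** whose
groups are the images of the stabilisers, with trivial compatibility 2-cells; it is `π₁`-epimorphic,
its kernels are the traces of the given kernels, and each of its branch ranges lies, inside `A`'s
vertex group, in a conjugate of the corresponding branch range of `A`.
[cite: MochizukiSemiAnbd2006, Def 2.3 pp.24-25] -/
theorem exists_approximator_coveringGraph (A : 𝒢.Approximator) :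
    ∃ A' : S.coveringGraph.Approximator,
      A'.IsPiOneEpimorphic ∧
      (∃ ιV : ∀ v' : S.coveringSemiGraph.Vertex, A'.FV v' →* A.FV v'.1,
        (∀ v', Function.Injective (ιV v')) ∧
        (∀ v', (ιV v').range = (BTemp.stab (S.SV v'.1) (Quot.out v'.2)).map (A.πV v'.1)) ∧
        (∀ v' (g : S.coveringGraph.Gv v'), ιV v' (A'.πV v' g) = A.πV v'.1 (g : 𝒢.Gv v'.1)) ∧
        ∀ (β : S.coveringSemiGraph.Branch) (v' : S.coveringSemiGraph.Vertex)
          (h : S.coveringSemiGraph.abuts β = some v'),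
          ∃ c : A.FV v'.1, ∀ x : A'.FE (S.coveringSemiGraph.edgeOf β),
            ιV v' (A'.brF β v' h x) ∈
              (A.brF β.1 v'.1 (S.abuts_of_coveringAbuts (b := β.1) (ω := β.2) (v := v'.1)
                (ωv := v'.2) h)).range.map (MulAut.conj c).toMonoidHom) ∧
      (∀ e' (g : S.coveringGraph.Ge e'), A'.πE e' g = 1 ↔ A.πE e'.1 (g : 𝒢.Ge e'.1) = 1) := by
  classical
  -- the conjugators of `A`'s compatibility 2-cells
  have hcomm := A.comm
  choose gb hgb using hcomm
  -- data
  let FV' : S.coveringSemiGraph.Vertex → Type u := fun v' =>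
    ↥((BTemp.stab (S.SV v'.1) (Quot.out v'.2)).map (A.πV v'.1))
  let FE' : S.coveringSemiGraph.Edge → Type u := fun e' =>
    ↥((BTemp.stab (S.SE e'.1) (Quot.out e'.2)).map (A.πE e'.1))
  let πV' : ∀ v', S.coveringGraph.Gv v' →* FV' v' := fun v' =>
    (A.πV v'.1).subgroupMap (BTemp.stab (S.SV v'.1) (Quot.out v'.2))
  let πE' : ∀ e', S.coveringGraph.Ge e' →* FE' e' := fun e' =>
    (A.πE e'.1).subgroupMap (BTemp.stab (S.SE e'.1) (Quot.out e'.2))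
  -- the conjugating element `c_{β} := π_v(g_{β}) · g_b⁻¹`
  let cc : ∀ (β : S.coveringSemiGraph.Branch) (v' : S.coveringSemiGraph.Vertex),
      S.coveringSemiGraph.abuts β = some v' → A.FV v'.1 := fun β v' h =>
    A.πV v'.1 (S.conjugator (b := β.1) (ω := β.2) (v := v'.1) (ωv := v'.2) h) *
      (gb β.1 v'.1 (S.abuts_of_coveringAbuts (b := β.1) (ω := β.2) (v := v'.1) (ωv := v'.2) h))⁻¹
  -- the raw branch map `x ↦ c · brF(x) · c⁻¹` on `A.FE`
  let raw : ∀ (β : S.coveringSemiGraph.Branch) (v' : S.coveringSemiGraph.Vertex)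
      (h : S.coveringSemiGraph.abuts β = some v'), FE' (S.coveringSemiGraph.edgeOf β) →* A.FV v'.1 :=
    fun β v' h => ((MulAut.conj (cc β v' h)).toMonoidHom.comp
      (A.brF β.1 v'.1 (S.abuts_of_coveringAbuts (b := β.1) (ω := β.2) (v := v'.1) (ωv := v'.2) h))).comp
      (Subgroup.subtype _)
  -- key computation: on `π_e(k)`, `k ∈ Stab_e`, the raw branch map is `π_v` of the covering branch map
  have hraw : ∀ (β : S.coveringSemiGraph.Branch) (v' : S.coveringSemiGraph.Vertex)
      (h : S.coveringSemiGraph.abuts β = some v')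
      (k : S.coveringGraph.Ge (S.coveringSemiGraph.edgeOf β)),
      raw β v' h (πE' _ k) = A.πV v'.1 ((S.coveringGraph.brHom β v' h k : S.coveringGraph.Gv v') :
        𝒢.Gv v'.1) := by
    rintro ⟨b, ω⟩ ⟨v, ωv⟩ h k
    have hb := S.abuts_of_coveringAbuts h
    change cc ⟨b, ω⟩ ⟨v, ωv⟩ h * A.brF b v hb (A.πE _ (k : 𝒢.Ge (𝒢.graph.edgeOf b))) *
        (cc ⟨b, ω⟩ ⟨v, ωv⟩ h)⁻¹ =
      A.πV v ((S.coveringBrHom h k : BTemp.stab (S.SV v) (Quot.out ωv)) : 𝒢.Gv v)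
    rw [S.coe_coveringBrHom, hgb b v hb, map_mul, map_mul, map_inv]
    simp only [cc, mul_inv_rev, inv_inv]
    group
  -- the raw branch map lands in `π_v(Stab_v)`
  have hmem : ∀ β v' h (x : FE' (S.coveringSemiGraph.edgeOf β)),
      raw β v' h x ∈ (BTemp.stab (S.SV v'.1) (Quot.out v'.2)).map (A.πV v'.1) := by
    intro β v' h x
    obtain ⟨k, hk⟩ := (A.πE _).subgroupMap_surjective _ x
    rw [← hk]
    change raw β v' h (πE' _ k) ∈ _
    rw [hraw]
    exact ⟨_, (S.coveringGraph.brHom β v' h k).2, rfl⟩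
  let brF' : ∀ (β : S.coveringSemiGraph.Branch) (v' : S.coveringSemiGraph.Vertex)
      (h : S.coveringSemiGraph.abuts β = some v'), FE' (S.coveringSemiGraph.edgeOf β) →* FV' v' :=
    fun β v' h => (raw β v' h).codRestrict _ (hmem β v' h)
  obtain ⟨MA, hMA, hMAdvd⟩ := A.bounded
  refine ⟨{ FV := FV', FE := FE', πV := πV', πE := πE',
            isOpen_ker_πV := ?_, isOpen_ker_πE := ?_, brF := brF',
            brF_injective := ?_, comm := ?_, bounded := ⟨MA, hMA, fun v' => ?_⟩ },
          ⟨fun v' => (A.πV v'.1).subgroupMap_surjective _,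
            fun e' => (A.πE e'.1).subgroupMap_surjective _⟩,
          ⟨fun v' => Subgroup.subtype _, fun v' => Subtype.val_injective,
            fun v' => Subgroup.range_subtype _, fun v' g => rfl, ?_⟩, ?_⟩
  · -- open kernels (vertices)
    intro v'
    have : (((πV' v').ker : Subgroup (S.coveringGraph.Gv v')) : Set (S.coveringGraph.Gv v')) =
        Subtype.val ⁻¹' ((A.πV v'.1).ker : Set (𝒢.Gv v'.1)) := by
      ext g
      simp only [SetLike.mem_coe, MonoidHom.mem_ker, Set.mem_preimage]
      exact ⟨fun hg => congrArg Subtype.val hg, fun hg => Subtype.ext hg⟩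
    rw [this]
    exact (A.isOpen_ker_πV v'.1).preimage continuous_subtype_val
  · -- open kernels (edges)
    intro e'
    have : (((πE' e').ker : Subgroup (S.coveringGraph.Ge e')) : Set (S.coveringGraph.Ge e')) =
        Subtype.val ⁻¹' ((A.πE e'.1).ker : Set (𝒢.Ge e'.1)) := by
      ext g
      simp only [SetLike.mem_coe, MonoidHom.mem_ker, Set.mem_preimage]
      exact ⟨fun hg => congrArg Subtype.val hg, fun hg => Subtype.ext hg⟩
    rw [this]
    exact (A.isOpen_ker_πE e'.1).preimage continuous_subtype_val
  · -- injective branch maps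
    intro β v' h x y hxy
    have hxy' : raw β v' h x = raw β v' h y := congrArg Subtype.val hxy
    apply Subtype.ext
    exact A.brF_injective β.1 v'.1 _ ((MulAut.conj (cc β v' h)).injective hxy')
  · -- trivial compatibility 2-cells
    intro β v' h
    refine ⟨1, fun k => Subtype.ext ?_⟩
    rw [one_mul, inv_one, mul_one]
    exact hraw β v' h k
  · -- bounded order
    exact (Subgroup.card_subgroup_dvd_card _).trans (hMAdvd v'.1)
  · -- branch ranges inside conjugates of `A`'s branch ranges
    intro β v' h
    refine ⟨cc β v' h, fun x => ?_⟩
    change raw β v' h x ∈ _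
    exact ⟨A.brF β.1 v'.1 _ (x : A.FE _), ⟨(x : A.FE _), rfl⟩, rfl⟩
  · -- kernels (edges)
    intro e' g
    exact ⟨fun hg => congrArg Subtype.val hg, fun hg => Subtype.ext hg⟩

/-! ### A kernel-control lemma: the characteristic open core acts trivially on small stabiliser-sets -/

/-- For an open subgroup `T ≤ Γ` and a FINITE continuous `T`-set `X`, every element of `T` lying in the
characteristic open core of `Γ` of level `≥ [Γ:T]·|X|` acts trivially on `X` (the stabilisers of the
points of `X` are open subgroups of `Γ` of index `≤ [Γ:T]·|X|`). [cite: MochizukiSemiAnbd2006, Def 2.3 pp.24-25] -/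
theorem charOpenCore_acts_trivially {Γ : Type u} [Group Γ] [TopologicalSpace Γ] [IsTopologicalGroup Γ]
    (T : Subgroup Γ) (hTo : IsOpen (T : Set Γ)) (hTi : T.index ≠ 0) (X : BTemp T)
    [Finite X.obj.V] {B : ℕ} (hB : T.index * Nat.card X.obj.V ≤ B)
    (g : T) (hg : (g : Γ) ∈ charOpenCore Γ B) (x : X.obj.V) : X.obj.ρ g x = x := by
  letI : MulAction T X.obj.V := Action.instMulAction X.obj
  -- the stabiliser of `x` in `T`, pushed into `Γ`
  set H : Subgroup T := MulAction.stabilizer T x with hH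
  have hHst : (H : Set T) = (BTemp.stab X x : Set T) := by
    ext t; exact Iff.rfl
  have hHo : IsOpen (H : Set T) := by rw [hHst]; exact X.property.2 x
  have hHeq : H.index = Nat.card (MulAction.orbit T x) := by
    rw [hH]
    exact Nat.card_congr (MulAction.orbitEquivQuotientStabilizer T x).symm
  have hHidx : H.index ≤ Nat.card X.obj.V := by
    rw [hHeq]
    exact Nat.card_le_card_of_injective (fun y : MulAction.orbit T x => (y : X.obj.V))
      Subtype.val_injective
  have hHidx0 : H.index ≠ 0 := by
    rw [hHeq]
    exact Nat.card_ne_zero.mpr ⟨⟨⟨x, MulAction.mem_orbit_self x⟩⟩, inferInstance⟩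
  have hU : H.map T.subtype ∈ openSubgroupsIndexLE Γ B := by
    refine ⟨hTo.isOpenEmbedding_subtypeVal.isOpenMap _ hHo, ?_, ?_⟩
    · rw [Subgroup.index_map_subtype]
      exact Nat.pos_of_ne_zero (mul_ne_zero hHidx0 hTi)
    · rw [Subgroup.index_map_subtype]
      calc H.index * T.index ≤ Nat.card X.obj.V * T.index := Nat.mul_le_mul_right _ hHidx
        _ = T.index * Nat.card X.obj.V := mul_comm _ _
        _ ≤ B := hB
  have hgH : g ∈ H := by
    obtain ⟨t, ht, hgt⟩ := charOpenCore_le hU hg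
    rwa [← Subtype.val_injective hgt]
  exact hgH

/-- An element acting trivially on the coset space `Γ/N` lies in `N`. [folklore] -/
private theorem mem_of_acts_trivially_quotientObj {Γ : Type u} [Group Γ] [TopologicalSpace Γ]
    [IsTopologicalGroup Γ] (hΓ : _root_.Literature.AnabelianGeometry.SemiGraphs.IsTempered Γ)
    (N : Subgroup Γ) (hN : IsOpen (N : Set Γ)) (g : Γ)
    (h : ∀ q : (BTemp.quotientObj Γ hΓ N hN).obj.V, (BTemp.quotientObj Γ hΓ N hN).obj.ρ g q = q) :
    g ∈ N := by
  have h1 := h ((1 : Γ) : Γ ⧸ N)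
  rw [GaloisObjects.quotientObj_ρ_one] at h1
  have h2 : ((g : Γ) : Γ ⧸ N) = ((1 : Γ) : Γ ⧸ N) := h1
  rw [QuotientGroup.eq, mul_one] at h2
  exact inv_mem_iff.mp h2

/-- Finite quotient by an open subgroup of a compact group. [folklore] -/
private theorem finite_quotient_of_isOpen' {Γ : Type u} [Group Γ] [TopologicalSpace Γ]
    [IsTopologicalGroup Γ] [CompactSpace Γ] (N : Subgroup Γ) (hN : IsOpen (N : Set Γ)) :
    Finite (Γ ⧸ N) := by
  haveI : DiscreteTopology (Γ ⧸ N) := QuotientGroup.discreteTopology_iff.mpr hN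
  exact finite_of_compact_of_discrete

/-! ### Quasi-coherence is hereditary over a finite coherent base -/

/-- **Quasi-coherence of `G_S` over a FINITE base** ([SemiAnbd] Def. 2.3 (iii) for the covering
semi-graph of anabelioids of a covering `S` all of whose constituents are split by ONE finite object `F`
with nonempty fibres — e.g. `S` tempered and connected — over a finite `G` that is quasi-coherent with
topologically finitely generated constituents, i.e. coherent): given finite stabiliser-sets of size
`≤ M` at every constituent of `G_S`, the characteristic open cores of the `Π_v`, `Π_e` of level
`|F_c|·M` are open (finite generation), of finite index (compactness), bounded uniformly (finiteness of
`G`); an approximator of `G` killing the quotients by them induces (`exists_approximator_coveringGraph`)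
the required approximator of `G_S`. [cite: MochizukiSemiAnbd2006, Def 2.3(iii) p.25] -/
theorem isQuasiCoherent_coveringGraph_of_finite [Finite 𝒢.graph.Vertex] [Finite 𝒢.graph.Edge]
    (hQC : 𝒢.IsQuasiCoherent)
    (htfgV : ∀ v, IsTopologicallyFinitelyGenerated (𝒢.Gv v))
    (htfgE : ∀ e, IsTopologicallyFinitelyGenerated (𝒢.Ge e))
    (hsplit : ∃ F : CovObj 𝒢, F.IsFinite ∧ F.HasNonemptyFibres ∧ ∀ q : S.Point, F.SplitsAt S q) :
    S.coveringGraph.IsQuasiCoherent := by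
  classical
  obtain ⟨F, hFfin, hFne, hFsplit⟩ := hsplit
  intro M HV HE hV hE
  haveI := hFfin.finite_V
  haveI := hFfin.finite_E
  -- levels and cores at the base constituents
  let BV : 𝒢.graph.Vertex → ℕ := fun v => Nat.card (F.SV v).obj.V * M
  let BE : 𝒢.graph.Edge → ℕ := fun e => Nat.card (F.SE e).obj.V * M
  let NV : ∀ v, Subgroup (𝒢.Gv v) := fun v => charOpenCore (𝒢.Gv v) (BV v)
  let NE : ∀ e, Subgroup (𝒢.Ge e) := fun e => charOpenCore (𝒢.Ge e) (BE e)
  have hNVo : ∀ v, IsOpen (NV v : Set (𝒢.Gv v)) := fun v => isOpen_charOpenCore_of_tfg (htfgV v) _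
  have hNEo : ∀ e, IsOpen (NE e : Set (𝒢.Ge e)) := fun e => isOpen_charOpenCore_of_tfg (htfgE e) _
  haveI hNVfin : ∀ v, Finite (𝒢.Gv v ⧸ NV v) := fun v => finite_quotient_of_isOpen' _ (hNVo v)
  haveI hNEfin : ∀ e, Finite (𝒢.Ge e ⧸ NE e) := fun e => finite_quotient_of_isOpen' _ (hNEo e)
  -- the test objects `Π_c / N_c` for the base, and a uniform bound
  let QV : ∀ v, BTemp (𝒢.Gv v) := fun v =>
    BTemp.quotientObj (𝒢.Gv v) IsTempered.of_profinite (NV v) (hNVo v)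
  let QE : ∀ e, BTemp (𝒢.Ge e) := fun e =>
    BTemp.quotientObj (𝒢.Ge e) IsTempered.of_profinite (NE e) (hNEo e)
  obtain ⟨M₁, hM₁⟩ := (Set.finite_range fun v : 𝒢.graph.Vertex => (NV v).index).bddAbove
  obtain ⟨M₂, hM₂⟩ := (Set.finite_range fun e : 𝒢.graph.Edge => (NE e).index).bddAbove
  have hQV : ∀ v, Nat.card (QV v).obj.V ≤ M₁ + M₂ ∧ Finite (QV v).obj.V := fun v =>
    ⟨(hM₁ ⟨v, rfl⟩).trans (Nat.le_add_right _ _), hNVfin v⟩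
  have hQE : ∀ e, Nat.card (QE e).obj.V ≤ M₁ + M₂ ∧ Finite (QE e).obj.V := fun e =>
    ⟨(hM₂ ⟨e, rfl⟩).trans (Nat.le_add_left _ _), hNEfin e⟩
  obtain ⟨A, hAV, hAE⟩ := hQC (M₁ + M₂) QV QE hQV hQE
  -- kernels of `A` lie in the cores
  have hkerV : ∀ v (g : 𝒢.Gv v), A.πV v g = 1 → g ∈ NV v := fun v g hg =>
    mem_of_acts_trivially_quotientObj _ _ _ g (hAV v g hg)
  have hkerE : ∀ e (g : 𝒢.Ge e), A.πE e g = 1 → g ∈ NE e := fun e g hg =>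
    mem_of_acts_trivially_quotientObj _ _ _ g (hAE e g hg)
  -- the induced approximator of `G_S`
  obtain ⟨A', -, ⟨ιV, hιinj, -, hιπ, -⟩, hkerE'⟩ := S.exists_approximator_coveringGraph A
  refine ⟨A', ?_, ?_⟩
  · rintro ⟨v, ω⟩ g hg x
    haveI := (hV ⟨v, ω⟩).2
    have hg1 : A.πV v (g : 𝒢.Gv v) = 1 := by rw [← hιπ ⟨v, ω⟩ g, hg, map_one]
    obtain ⟨x₀⟩ := hFne.nonempty_V v
    obtain ⟨hidx0, hidx⟩ := index_stab_le (X := S.SV v) x₀ (Quot.out ω) (hFsplit (Sum.inl ⟨v, Quot.out ω⟩))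
    exact charOpenCore_acts_trivially (BTemp.stab (S.SV v) (Quot.out ω)) ((S.SV v).property.2 _) hidx0
      (HV ⟨v, ω⟩) (Nat.mul_le_mul hidx (hV ⟨v, ω⟩).1) g (hkerV v _ hg1) x
  · rintro ⟨e, ω⟩ g hg x
    haveI := (hE ⟨e, ω⟩).2
    have hg1 : A.πE e (g : 𝒢.Ge e) = 1 := (hkerE' ⟨e, ω⟩ g).mp hg
    obtain ⟨x₀⟩ := hFne.nonempty_E e
    obtain ⟨hidx0, hidx⟩ := index_stab_le (X := S.SE e) x₀ (Quot.out ω) (hFsplit (Sum.inr ⟨e, Quot.out ω⟩))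
    exact charOpenCore_acts_trivially (BTemp.stab (S.SE e) (Quot.out ω)) ((S.SE e).property.2 _) hidx0
      (HE ⟨e, ω⟩) (Nat.mul_le_mul hidx (hE ⟨e, ω⟩).1) g (hkerE e _ hg1) x

/-! ### Elevation is hereditary (any tempered `S`, any base) -/

/-- Cardinality bookkeeping: for subgroups `N, H` of a finite group with `[G : H] ≤ d` and
`M·d ≤ |N|`, the intersection `H ⊓ N` has at least `M` elements. [folklore] -/
private theorem le_card_inf_of_index_le {G : Type*} [Group G] [Finite G] (N H : Subgroup G) {M d : ℕ}
    (hd : H.index ≤ d) (hN : M * d ≤ Nat.card N) : M ≤ Nat.card (H ⊓ N : Subgroup G) := by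
  have hHi : H.index ≠ 0 := Subgroup.index_ne_zero_of_finite
  have hrel : H.relIndex N ≤ d :=
    ((Subgroup.relIndex_le_of_le_right (K := N) le_top (by rwa [Subgroup.relIndex_top_right])).trans
      (by rw [Subgroup.relIndex_top_right]; exact hd))
  have hcard : Nat.card (H ⊓ N : Subgroup G) * H.relIndex N = Nat.card N := by
    have h1 := Subgroup.card_mul_index (H.subgroupOf N)
    rwa [← Subgroup.card_map_of_injective N.subtype_injective (K := H.subgroupOf N),
      Subgroup.subgroupOf_map_subtype] at h1
  have hdpos : 0 < d := by
    rcases Nat.eq_zero_or_pos d with h | h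
    · rw [h] at hd
      exact absurd (Nat.le_zero.mp hd) hHi
    · exact h
  apply Nat.le_of_mul_le_mul_right _ hdpos
  calc M * d ≤ Nat.card N := hN
    _ = Nat.card (H ⊓ N : Subgroup G) * H.relIndex N := hcard.symm
    _ ≤ Nat.card (H ⊓ N : Subgroup G) * d := Nat.mul_le_mul_left _ hrel

/-- **Elevation is hereditary** ([SemiAnbd] Rmk. 2.4.1 "`v' ↦ v` elevated ⇒ `v'` elevated", for the
covering semi-graph of anabelioids `G_S` of a TEMPERED object `S` over a totally elevated `G`; no
finiteness of `G` is needed): at `(v, ω)` and level `M`, a `π₁`-epimorphic approximator of `G`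
elevating `v` at level `M·[Π_v : Stab_ω]` induces (`exists_approximator_coveringGraph`) a
`π₁`-epimorphic approximator of `G_S` whose vertex group at `(v, ω)` contains the trace of the
witnessing subgroup, of order `≥ M`, still meeting every conjugate of every branch image trivially.
[cite: MochizukiSemiAnbd2006, Rmk 2.4.1 p.26] -/
theorem isTotallyElevated_coveringGraph (hTE : 𝒢.IsTotallyElevated) (hS : S.IsTempered) :
    S.coveringGraph.IsTotallyElevated := by
  classical
  rintro ⟨v, ω⟩ M
  -- the orbit bound at `(v, ω)` from temperedness
  obtain ⟨F, hFfin, hFne, hFsplit⟩ := hS (Sum.inl ⟨v, Quot.out ω⟩)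
  haveI := hFfin.finite_V
  obtain ⟨x₀⟩ := hFne.nonempty_V v
  obtain ⟨hT0, hTd⟩ := index_stab_le (X := S.SV v) x₀ (Quot.out ω)
    (hFsplit (Sum.inl ⟨v, Quot.out ω⟩) (Relation.EqvGen.refl _))
  set T := BTemp.stab (S.SV v) (Quot.out ω)
  set d := Nat.card (F.SV v).obj.V
  -- the base approximator at level `M·d`
  obtain ⟨A, hAepi, N, hN, hNbot⟩ := hTE v (M * d)
  obtain ⟨A', hA'epi, ⟨ιV, hιinj, hιrange, hιπ, hbr⟩, -⟩ := S.exists_approximator_coveringGraph A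
  refine ⟨A', hA'epi, N.comap (ιV ⟨v, ω⟩), ?_, ?_⟩
  · -- order ≥ M
    have hcard : Nat.card (N.comap (ιV ⟨v, ω⟩)) = Nat.card ((ιV ⟨v, ω⟩).range ⊓ N : Subgroup (A.FV v)) := by
      rw [← Subgroup.map_comap_eq, Subgroup.card_map_of_injective (hιinj ⟨v, ω⟩)]
    rw [hcard]
    refine le_card_inf_of_index_le N _ ?_ hN
    rw [hιrange ⟨v, ω⟩]
    exact (Nat.le_of_dvd (Nat.pos_of_ne_zero hT0) (Subgroup.index_map_dvd T (hAepi.1 v))).trans hTd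
  · -- trivial intersections with conjugates of branch images
    intro β h g'
    obtain ⟨c, hc⟩ := hbr β ⟨v, ω⟩ h
    rw [eq_bot_iff]
    rintro x ⟨hxN, hx⟩
    obtain ⟨y, ⟨z, rfl⟩, rfl⟩ := hx
    rw [Subgroup.mem_bot]
    apply hιinj ⟨v, ω⟩
    rw [map_one]
    have hmem : ιV ⟨v, ω⟩ ((MulAut.conj g').toMonoidHom (A'.brF β ⟨v, ω⟩ h z)) ∈
        N ⊓ ((A.brF β.1 v (S.abuts_of_coveringAbuts (b := β.1) (ω := β.2) (v := v) (ωv := ω) h)).range.map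
          (MulAut.conj (ιV ⟨v, ω⟩ g' * c)).toMonoidHom) := by
      refine ⟨hxN, ?_⟩
      obtain ⟨r, hr, hr'⟩ := hc z
      refine ⟨r, hr, ?_⟩
      change (ιV ⟨v, ω⟩ g' * c) * r * (ιV ⟨v, ω⟩ g' * c)⁻¹ =
        ιV ⟨v, ω⟩ (g' * A'.brF β ⟨v, ω⟩ h z * g'⁻¹)
      have hr'' : c * r * c⁻¹ = ιV ⟨v, ω⟩ (A'.brF β ⟨v, ω⟩ h z) := hr'
      rw [map_mul, map_mul, map_inv, ← hr'']
      group
    rw [hNbot β.1 _ (ιV ⟨v, ω⟩ g' * c)] at hmem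
    exact hmem

end CovObj

end ProfiniteSemiGraph

end Literature.AnabelianGeometry.SemiGraphs
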